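import Literature.MathematicalPhysics.QuantumManyBody.GroundStateFeynmanKacMarkov
import HarnessLib

/-!
# Ground-state Feynman–Kac: the semigroup law `e^{-(s+t)H_N} = e^{-sH_N} e^{-tH_N}` path-wise

Topic `Literature/MathematicalPhysics/QuantumManyBody`; theorems only (no new definition, no named
fact). Second step of the proof of the named fact
`Literature.MathematicalPhysics.QuantumManyBody.BoseGas.GroundStateFeynmanKac`: from the weak
Markov property of the `3N` Brownian coordinates (`GroundStateFeynmanKacMarkov.lean`) we derive
the **semigroup (Chapman–Kolmogorov) law of the Feynman–Kac functional**

  `fkSemigroup v L (s + t) g X = fkSemigroup v L s (fkSemigroup v L t g) X`  (`s, t ≥ 0`, every `X`)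

(`fkSemigroup_add`), exactly as in Chung–Zhao (1995), §3.2 (the display before Theorem 3.10):
`T_{s+t} f(x) = E^x{e_q(s) [e_q(t) f(X_t)] ∘ θ_s} = E^x{e_q(s) E^{X_s}[e_q(t) f(X_t)]} = T_s T_t f(x)`,
here with the killing `t < τ_D` built into the weight.

To apply the Markov factorisation `lintegral_comp_pathsShift_eq` the functional
`ω ↦ 𝟙{τ > t} e^{-∫₀ᵗ V} g(B_t)` must be written as an honest measurable functional of RAW paths
(the shifted path `θ_s ω` is a raw path, and the canonical process `brownian` is only a
modification of the coordinate process): we read raw paths through the measurable regularisation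
`Literature.Probability.Process.pathRegularize`, which is the identity on continuous paths, so that
on Brownian paths, shifted Brownian paths and stopped Brownian paths the raw functionals ARE the
world-lines / survival event / action / weight of `GroundStateFeynmanKac.lean`. Contents:

* `forall_mem_Icc_iff_rat` — countable description of "a continuous curve stays in an open set
  during `[0, T]`" (rational times), whence measurability of such events
  (`measurableSet_forall_mem_Icc`);
* measurability of the raw world-line `(Y, w, r) ↦ Y + √2 w̄(r)`, of the raw survival event, the
  raw action and the raw weight, jointly in the starting point and the raw path;
* identification on continuous paths (`raw_worldLine_of_continuous`) and its three instances:
  Brownian paths (`= worldLine`), shifted paths (`= worldLine X ω (s + ·)`), stopped paths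
  (`= worldLine X ω (· ∧ s)`), and the corresponding values of the raw weight;
* the splitting of the survival event, of the action and of the weight at time `s`
  (`fkWeight_add_eq_mul`);
* joint measurability of `(X, ω) ↦ fkWeight v L t X ω`, measurability of
  `X ↦ fkSemigroup v L t g X` (`measurable_fkSemigroup`), past-measurability of
  `(fkWeight v L s X, worldLine X · s)`;
* the semigroup law `fkSemigroup_add`.

## References

* K. L. Chung, Z. Zhao, *From Brownian Motion to Schrödinger's Equation*, Grundlehren 312,
  Springer (1995), §3.2 (before Thm 3.10) and §3.3 (3.34). [ChungZhao1995]
* D. Revuz, M. Yor, *Continuous Martingales and Brownian Motion* (1999), Ch. III §1.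
-/

noncomputable section

namespace Literature.MathematicalPhysics.QuantumManyBody.BoseGas

open MeasureTheory ProbabilityTheory Filter Set Metric
open scoped ENNReal NNReal Topology
open Literature.Probability.Process

variable {N : ℕ}

/-! ### A countable description of "the curve stays in the open set on `[0, T]`" -/

/-- **Countable description of staying inside an open set.** A continuous curve `γ : ℝ → E` stays
in the open set `U` during `[0, T]` iff, for some `n`, at every RATIONAL time of `[0, T]` it is at
extended distance `≥ 1/n` from `Uᶜ` (compactness of the arc one way; closedness of
`{s | 1/n ≤ d(γ s, Uᶜ)}` and density of the rationals — with the rational endpoint `0` — the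
other way). [folklore] -/
theorem forall_mem_Icc_iff_rat {E : Type*} [PseudoEMetricSpace E] {U : Set E} (hU : IsOpen U)
    {γ : ℝ → E} (hγ : Continuous γ) (T : ℝ) :
    (∀ s ∈ Set.Icc (0 : ℝ) T, γ s ∈ U) ↔
      ∃ n : ℕ, ∀ q : ℚ, (q : ℝ) ∈ Set.Icc (0 : ℝ) T → (n : ℝ≥0∞)⁻¹ ≤ infEDist (γ q) Uᶜ := by
  constructor
  · intro h
    have hK : IsCompact (γ '' Set.Icc 0 T) := isCompact_Icc.image hγ
    have hdisj : Disjoint (γ '' Set.Icc 0 T) Uᶜ := by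
      refine Set.disjoint_left.2 ?_
      rintro _ ⟨s, hs, rfl⟩ hF
      exact hF (h s hs)
    obtain ⟨r, hr, hK'⟩ := exists_pos_forall_lt_edist hK hU.isClosed_compl hdisj
    obtain ⟨n, hn⟩ := ENNReal.exists_inv_nat_lt (a := r) (by exact_mod_cast hr.ne')
    refine ⟨n, fun q hq => hn.le.trans ?_⟩
    exact le_infEDist.2 fun y hy => (hK' _ ⟨q, hq, rfl⟩ y hy).le
  · rintro ⟨n, hn⟩ s hs
    set S : Set ℝ := {s | (n : ℝ≥0∞)⁻¹ ≤ infEDist (γ s) Uᶜ} with hS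
    have hSc : IsClosed S := isClosed_le continuous_const (continuous_infEDist.comp hγ)
    have hrat : Set.Ioo 0 T ∩ Set.range ((↑) : ℚ → ℝ) ⊆ S := by
      rintro _ ⟨hq, q, rfl⟩
      exact hn q (Set.Ioo_subset_Icc_self hq)
    have hIoo : Set.Ioo 0 T ⊆ S :=
      (Rat.denseRange_cast.open_subset_closure_inter isOpen_Ioo).trans (closure_minimal hrat hSc)
    have hsS : s ∈ S := by
      rcases eq_or_lt_of_le hs.1 with h0 | h0
      · have h00 := hn 0 (by simpa [← h0] using hs)
        show (n : ℝ≥0∞)⁻¹ ≤ infEDist (γ s) Uᶜ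
        rw [← h0]
        simpa using h00
      · have hT : (0 : ℝ) ≠ T := (h0.trans_le hs.2).ne
        have : s ∈ closure (Set.Ioo 0 T) := by
          rw [closure_Ioo hT]; exact hs
        exact closure_minimal hIoo hSc this
    have hpos : 0 < infEDist (γ s) Uᶜ :=
      lt_of_lt_of_le (ENNReal.inv_pos.2 (ENNReal.natCast_ne_top n)) hsS
    have := infEDist_pos_iff_notMem_closure.1 hpos
    rwa [hU.isClosed_compl.closure_eq, Set.notMem_compl_iff] at this

/-- Measurability of "the curve stays in the open set during `[0, T]`" for a family of continuous
curves depending measurably on a parameter. [folklore] -/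
theorem measurableSet_forall_mem_Icc {α E : Type*} [MeasurableSpace α] [PseudoEMetricSpace E]
    [MeasurableSpace E] [OpensMeasurableSpace E] {U : Set E} (hU : IsOpen U) {γ : α → ℝ → E}
    (hc : ∀ a, Continuous (γ a)) (hm : ∀ s, Measurable fun a => γ a s) (T : ℝ) :
    MeasurableSet {a | ∀ s ∈ Set.Icc (0 : ℝ) T, γ a s ∈ U} := by
  have heq : {a | ∀ s ∈ Set.Icc (0 : ℝ) T, γ a s ∈ U} = ⋃ n : ℕ, ⋂ q : ℚ,
      {a | (q : ℝ) ∈ Set.Icc (0 : ℝ) T → (n : ℝ≥0∞)⁻¹ ≤ infEDist (γ a q) Uᶜ} := by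
    ext a
    simp only [Set.mem_setOf_eq, Set.mem_iUnion, Set.mem_iInter]
    exact forall_mem_Icc_iff_rat hU (hc a) T
  rw [heq]
  refine MeasurableSet.iUnion fun n => MeasurableSet.iInter fun q => ?_
  by_cases hq : (q : ℝ) ∈ Set.Icc (0 : ℝ) T
  · simp only [hq, forall_const]
    exact measurableSet_le measurable_const (continuous_infEDist.measurable.comp (hm _))
  · simp [hq]

/-! ### Raw-path world-lines -/

/-- **Joint measurability of the raw world-line** `((Y, w), r) ↦ Y + √2 w̄(r⁺)` in the starting
point `Y`, the raw paths `w` (product σ-algebra) and real time `r`, where `w̄ = pathRegularize w`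
coordinate-wise. [folklore] -/
theorem measurable_rawWorldLine (N : ℕ) :
    Measurable fun p : (Config N × PathSpace N) × ℝ => fun i : Fin N =>
      p.1.1 i + WithLp.toLp 2 (fun k : Fin 3 =>
        Real.sqrt 2 * pathRegularize (p.1.2 i k) p.2.toNNReal) := by
  refine measurable_pi_lambda _ fun i => ?_
  refine ((measurable_pi_apply i).comp (measurable_fst.comp measurable_fst)).add ?_
  refine (WithLp.measurable_toLp 2 _).comp (measurable_pi_lambda _ fun k => ?_)
  refine measurable_const.mul ?_
  have h1 : Measurable fun p : (Config N × PathSpace N) × ℝ => (p.1.2 i k, p.2.toNNReal) :=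
    ((measurable_pi_apply k).comp ((measurable_pi_apply i).comp
      (measurable_snd.comp measurable_fst))).prodMk (measurable_real_toNNReal.comp measurable_snd)
  exact measurable_uncurry_pathRegularize.comp h1

/-- The raw world-line at a fixed real time is measurable in `(Y, w)`. [folklore] -/
theorem measurable_rawWorldLine_at (N : ℕ) (r : ℝ) :
    Measurable fun p : Config N × PathSpace N => fun i : Fin N =>
      p.1 i + WithLp.toLp 2 (fun k : Fin 3 => Real.sqrt 2 * pathRegularize (p.2 i k) r.toNNReal) :=
  (measurable_rawWorldLine N).comp (measurable_id.prodMk measurable_const)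

/-- The raw world-line at a fixed `ℝ≥0` time is measurable in `(Y, w)`. [folklore] -/
theorem measurable_rawWorldLine_at' (N : ℕ) (r : ℝ≥0) :
    Measurable fun p : Config N × PathSpace N => fun i : Fin N =>
      p.1 i + WithLp.toLp 2 (fun k : Fin 3 => Real.sqrt 2 * pathRegularize (p.2 i k) r) := by
  simpa only [Real.toNNReal_coe] using measurable_rawWorldLine_at N (r : ℝ)

/-- The raw world-line is continuous in real time, for every raw path. [folklore] -/
theorem continuous_rawWorldLine (Y : Config N) (w : PathSpace N) :
    Continuous fun r : ℝ => fun i : Fin N =>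
      Y i + WithLp.toLp 2 (fun k : Fin 3 => Real.sqrt 2 * pathRegularize (w i k) r.toNNReal) := by
  refine continuous_pi fun i => continuous_const.add ?_
  exact (PiLp.continuous_toLp 2 _).comp
    (continuous_pi fun k => continuous_const.mul (continuous_pathRegularize_toNNReal (w i k)))

/-- The raw survival event `{(Y, w) | ∀ r ∈ [0, t], Y + √2 w̄(r) ∈ Λ_L^N}` is measurable. [folklore] -/
theorem measurableSet_rawSurvives (N : ℕ) (L t : ℝ) :
    MeasurableSet {p : Config N × PathSpace N | ∀ r ∈ Set.Icc (0 : ℝ) t, (fun i : Fin N =>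
      p.1 i + WithLp.toLp 2 (fun k : Fin 3 =>
        Real.sqrt 2 * pathRegularize (p.2 i k) r.toNNReal)) ∈ boxN N L} :=
  measurableSet_forall_mem_Icc (isOpen_boxN N L)
    (fun p : Config N × PathSpace N => continuous_rawWorldLine p.1 p.2)
    (fun r => measurable_rawWorldLine_at N r) t

/-- The raw action `(Y, w) ↦ ∫₀ᵗ ∑_{i<j} v(|·|)(Y + √2 w̄(r)) dr` is measurable (Tonelli).
[folklore] -/
theorem measurable_rawAction (N : ℕ) {v : ℝ → ℝ≥0∞} (hv : Measurable v) (t : ℝ) :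
    Measurable fun p : Config N × PathSpace N => ∫⁻ r in Set.Ioc (0 : ℝ) t,
      interaction v (fun i : Fin N => p.1 i + WithLp.toLp 2 (fun k : Fin 3 =>
        Real.sqrt 2 * pathRegularize (p.2 i k) r.toNNReal)) :=
  ((measurable_interaction hv).comp (measurable_rawWorldLine N)).lintegral_prod_right'

/-- The raw Feynman–Kac weight `(Y, w) ↦ 𝟙{raw survival} e^{-raw action}` is measurable. [folklore] -/
theorem measurable_rawWeight (N : ℕ) {v : ℝ → ℝ≥0∞} (hv : Measurable v) (L t : ℝ) :
    Measurable fun p : Config N × PathSpace N =>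
      {p : Config N × PathSpace N | ∀ r ∈ Set.Icc (0 : ℝ) t, (fun i : Fin N =>
        p.1 i + WithLp.toLp 2 (fun k : Fin 3 =>
          Real.sqrt 2 * pathRegularize (p.2 i k) r.toNNReal)) ∈ boxN N L}.indicator
      (fun p => expNeg (∫⁻ r in Set.Ioc (0 : ℝ) t,
        interaction v (fun i : Fin N => p.1 i + WithLp.toLp 2 (fun k : Fin 3 =>
          Real.sqrt 2 * pathRegularize (p.2 i k) r.toNNReal)))) p :=
  (measurable_expNeg.comp (measurable_rawAction N hv t)).indicator (measurableSet_rawSurvives N L t)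

/-- **On continuous raw paths the regularisation disappears**: the raw world-line is
`Y + √2 w(r)`. [folklore] -/
theorem raw_worldLine_of_continuous (Y : Config N) {w : PathSpace N}
    (hw : ∀ i k, Continuous (w i k)) (r : ℝ≥0) :
    (fun i : Fin N => Y i + WithLp.toLp 2 (fun k : Fin 3 => Real.sqrt 2 * pathRegularize (w i k) r)) =
      fun i => Y i + WithLp.toLp 2 (fun k => Real.sqrt 2 * w i k r) := by
  funext i
  have h : (fun k : Fin 3 => Real.sqrt 2 * pathRegularize (w i k) r) =
      fun k => Real.sqrt 2 * w i k r := by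
    funext k
    rw [pathRegularize_eq_self_of_continuous (hw i k)]
  rw [h]

/-- On the Brownian paths `w = b(ω')` the raw world-line is the world-line `worldLine Y ω'`.
[folklore] -/
theorem raw_worldLine_pathsPath (Y : Config N) (ω' : PathSpace N) (r : ℝ≥0) :
    (fun i : Fin N => Y i + WithLp.toLp 2 (fun k : Fin 3 =>
      Real.sqrt 2 * pathRegularize (fun u => brownian u (ω' i k)) r)) = worldLine Y ω' r := by
  rw [raw_worldLine_of_continuous Y (w := fun i k u => brownian u (ω' i k))
    (fun i k => continuous_brownian _)]
  rfl

/-- On the shifted paths `θ_s ω`, started from `B_s(ω)`, the raw world-line at time `u` is the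
world-line of `ω` at time `s + u` (additivity `X + √2 b_s + √2 (b_{s+u} - b_s) = X + √2 b_{s+u}`).
[folklore] -/
theorem raw_worldLine_pathsShift (X : Config N) (ω : PathSpace N) (s u : ℝ≥0) :
    (fun i : Fin N => worldLine X ω s i + WithLp.toLp 2 (fun k : Fin 3 =>
      Real.sqrt 2 * pathRegularize (fun u => brownian (s + u) (ω i k) - brownian s (ω i k)) u)) =
      worldLine X ω (s + u) := by
  rw [raw_worldLine_of_continuous (worldLine X ω s)
    (w := fun i k u => brownian (s + u) (ω i k) - brownian s (ω i k))
    (fun i k => ((continuous_brownian _).comp (continuous_const.add continuous_id)).sub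
      continuous_const)]
  funext i
  have h : (fun k : Fin 3 => Real.sqrt 2 * brownian s (ω i k)) +
      (fun k => Real.sqrt 2 * (brownian (s + u) (ω i k) - brownian s (ω i k))) =
      fun k => Real.sqrt 2 * brownian (s + u) (ω i k) := by
    funext k
    simp only [Pi.add_apply]
    ring
  simp only [worldLine]
  rw [add_assoc]
  congr 1
  rw [← WithLp.toLp_add, h]

/-- On the stopped paths `u ↦ b_{u ∧ s}`, the raw world-line at time `r` is the world-line at
time `r ∧ s`. [folklore] -/
theorem raw_worldLine_stopped (X : Config N) (ω : PathSpace N) (s r : ℝ≥0) :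
    (fun i : Fin N => X i + WithLp.toLp 2 (fun k : Fin 3 =>
      Real.sqrt 2 * pathRegularize (fun u => brownian (min u s) (ω i k)) r)) =
      worldLine X ω (min r s) := by
  rw [raw_worldLine_of_continuous X (w := fun i k u => brownian (min u s) (ω i k))
    (fun i k => (continuous_brownian _).comp (continuous_id.min continuous_const))]
  rfl

/-! ### Splitting the weight at time `s` -/

/-- Real-time bookkeeping: `(s + r)⁺ = s + r⁺` for `r ≥ 0`. [folklore] -/
theorem toNNReal_coe_add {s : ℝ≥0} {r : ℝ} (hr : 0 ≤ r) :
    ((s : ℝ) + r).toNNReal = s + r.toNNReal := by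
  rw [Real.toNNReal_add s.coe_nonneg hr, Real.toNNReal_coe]

/-- **Splitting the survival event at time `s`**: the world-lines stay in the box during
`[0, s + t]` iff they do during `[0, s]` and the world-lines read from time `s` on do during
`[0, t]`. [folklore] -/
theorem mem_survives_add_iff (L : ℝ) (s t : ℝ≥0) (X : Config N) (ω : PathSpace N) :
    ω ∈ survives L ((s : ℝ) + t) X ↔ ω ∈ survives L s X ∧
      ∀ r ∈ Set.Icc (0 : ℝ) t, worldLine X ω (s + r.toNNReal) ∈ boxN N L := by
  simp only [survives, Set.mem_setOf_eq]
  constructor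
  · intro h
    refine ⟨fun r hr => h r ⟨hr.1, hr.2.trans (by simp)⟩, fun r hr => ?_⟩
    have := h (s + r) ⟨add_nonneg s.coe_nonneg hr.1, by linarith [hr.2]⟩
    rwa [toNNReal_coe_add hr.1] at this
  · rintro ⟨h1, h2⟩ r hr
    rcases le_or_gt r s with hrs | hrs
    · exact h1 r ⟨hr.1, hrs⟩
    · have h := h2 (r - s) ⟨by linarith, by linarith [hr.2]⟩
      have e : (s : ℝ) + (r - s) = r := by ring
      rwa [← toNNReal_coe_add (by linarith), e] at h

/-- **Splitting the action at time `s`**: `∫₀^{s+t} = ∫₀ˢ + ∫₀ᵗ (s + ·)` (additivity of the time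
integral and translation invariance of Lebesgue measure). [folklore] -/
theorem pathAction_add (v : ℝ → ℝ≥0∞) (s t : ℝ≥0) (X : Config N) (ω : PathSpace N) :
    pathAction v ((s : ℝ) + t) X ω = pathAction v s X ω +
      ∫⁻ r in Set.Ioc (0 : ℝ) t, interaction v (worldLine X ω (s + r.toNNReal)) := by
  simp only [pathAction]
  rw [← Set.Ioc_union_Ioc_eq_Ioc (a := (0 : ℝ)) (b := (s : ℝ)) s.coe_nonneg (by simp),
    lintegral_union measurableSet_Ioc (Set.Ioc_disjoint_Ioc.2 (by simp))]
  congr 1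
  rw [← lintegral_indicator measurableSet_Ioc, ← lintegral_indicator measurableSet_Ioc,
    ← lintegral_add_right_eq_self (μ := (volume : Measure ℝ)) _ (s : ℝ)]
  refine lintegral_congr fun r => ?_
  by_cases hr : r ∈ Set.Ioc (0 : ℝ) t
  · have hr' : r + s ∈ Set.Ioc (s : ℝ) (s + t) := ⟨by linarith [hr.1], by linarith [hr.2]⟩
    rw [Set.indicator_of_mem hr', Set.indicator_of_mem hr, add_comm r s, toNNReal_coe_add hr.1.le]
  · have hr' : r + s ∉ Set.Ioc (s : ℝ) (s + t) := fun h => hr ⟨by linarith [h.1], by linarith [h.2]⟩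
    rw [Set.indicator_of_notMem hr', Set.indicator_of_notMem hr]

/-- **Splitting the Feynman–Kac weight at time `s`** (multiplicativity of the killing indicator
and of `e^{-∫V}`): `w_{s+t}(ω) = w_s(ω) · [𝟙{∀ r ≤ t, B_{s+r} ∈ Λ^N} e^{-∫₀ᵗ V(B_{s+r}) dr}]`.
Chung–Zhao (1995), §3.2 (`e_q(s+t) = e_q(s) [e_q(t) ∘ θ_s]`). [folklore] -/
theorem fkWeight_add_eq_mul (v : ℝ → ℝ≥0∞) (L : ℝ) (s t : ℝ≥0) (X : Config N) (ω : PathSpace N) :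
    fkWeight v L ((s : ℝ) + t) X ω = fkWeight v L s X ω *
      {ω' : PathSpace N | ∀ r ∈ Set.Icc (0 : ℝ) t, worldLine X ω' (s + r.toNNReal) ∈ boxN N L}.indicator
        (fun ω' => expNeg (∫⁻ r in Set.Ioc (0 : ℝ) t,
          interaction v (worldLine X ω' (s + r.toNNReal)))) ω := by
  simp only [fkWeight]
  by_cases h : ω ∈ survives L ((s : ℝ) + t) X
  · have h' := (mem_survives_add_iff L s t X ω).1 h
    have h2 : ω ∈ {ω' : PathSpace N | ∀ r ∈ Set.Icc (0 : ℝ) t,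
        worldLine X ω' (s + r.toNNReal) ∈ boxN N L} := h'.2
    rw [Set.indicator_of_mem h, Set.indicator_of_mem h'.1, Set.indicator_of_mem h2,
      pathAction_add, expNeg_add]
  · rw [Set.indicator_of_notMem h]
    rw [mem_survives_add_iff] at h
    by_cases h1 : ω ∈ survives L s X
    · have h2 : ω ∉ {ω' : PathSpace N | ∀ r ∈ Set.Icc (0 : ℝ) t,
          worldLine X ω' (s + r.toNNReal) ∈ boxN N L} := fun h2 => h ⟨h1, h2⟩
      rw [Set.indicator_of_notMem h2, mul_zero]
    · rw [Set.indicator_of_notMem h1, zero_mul]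

/-! ### The raw weight on Brownian, shifted and stopped paths -/

/-- **The raw weight of the Brownian paths is the Feynman–Kac weight**:
`rawWeight t Y (b(ω')) = fkWeight v L t Y ω'`. [folklore] -/
theorem rawWeight_pathsPath (v : ℝ → ℝ≥0∞) (L t : ℝ) (Y : Config N) (ω' : PathSpace N) :
    {p : Config N × PathSpace N | ∀ r ∈ Set.Icc (0 : ℝ) t, (fun i : Fin N =>
        p.1 i + WithLp.toLp 2 (fun k : Fin 3 =>
          Real.sqrt 2 * pathRegularize (p.2 i k) r.toNNReal)) ∈ boxN N L}.indicator
      (fun p => expNeg (∫⁻ r in Set.Ioc (0 : ℝ) t,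
        interaction v (fun i : Fin N => p.1 i + WithLp.toLp 2 (fun k : Fin 3 =>
          Real.sqrt 2 * pathRegularize (p.2 i k) r.toNNReal))))
      (Y, fun i k u => brownian u (ω' i k)) = fkWeight v L t Y ω' := by
  have hmem : ((Y, fun (i : Fin N) (k : Fin 3) (u : ℝ≥0) => brownian u (ω' i k)) ∈
      {p : Config N × PathSpace N | ∀ r ∈ Set.Icc (0 : ℝ) t, (fun i : Fin N =>
        p.1 i + WithLp.toLp 2 (fun k : Fin 3 =>
          Real.sqrt 2 * pathRegularize (p.2 i k) r.toNNReal)) ∈ boxN N L}) ↔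
      ω' ∈ survives L t Y := by
    simp only [Set.mem_setOf_eq, survives, raw_worldLine_pathsPath]
  have hact : (∫⁻ r in Set.Ioc (0 : ℝ) t, interaction v (fun i : Fin N => Y i +
      WithLp.toLp 2 (fun k : Fin 3 => Real.sqrt 2 *
        pathRegularize (fun u => brownian u (ω' i k)) r.toNNReal))) = pathAction v t Y ω' := by
    simp only [pathAction, raw_worldLine_pathsPath]
  simp only [fkWeight]
  by_cases hω : ω' ∈ survives L t Y
  · rw [Set.indicator_of_mem hω, Set.indicator_of_mem (hmem.2 hω), hact]
  · rw [Set.indicator_of_notMem hω, Set.indicator_of_notMem (fun h => hω (hmem.1 h))]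

/-- **The raw weight of the shifted paths, started from `B_s`, is the `[s, s+t]`-part of the
weight.** [folklore] -/
theorem rawWeight_pathsShift (v : ℝ → ℝ≥0∞) (L : ℝ) (s t : ℝ≥0) (X : Config N) (ω : PathSpace N) :
    {p : Config N × PathSpace N | ∀ r ∈ Set.Icc (0 : ℝ) t, (fun i : Fin N =>
        p.1 i + WithLp.toLp 2 (fun k : Fin 3 =>
          Real.sqrt 2 * pathRegularize (p.2 i k) r.toNNReal)) ∈ boxN N L}.indicator
      (fun p => expNeg (∫⁻ r in Set.Ioc (0 : ℝ) t,
        interaction v (fun i : Fin N => p.1 i + WithLp.toLp 2 (fun k : Fin 3 =>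
          Real.sqrt 2 * pathRegularize (p.2 i k) r.toNNReal))))
      (worldLine X ω s, fun i k u => brownian (s + u) (ω i k) - brownian s (ω i k)) =
    {ω' : PathSpace N | ∀ r ∈ Set.Icc (0 : ℝ) t, worldLine X ω' (s + r.toNNReal) ∈ boxN N L}.indicator
      (fun ω' => expNeg (∫⁻ r in Set.Ioc (0 : ℝ) t,
        interaction v (worldLine X ω' (s + r.toNNReal)))) ω := by
  have hmem : ((worldLine X ω s, fun (i : Fin N) (k : Fin 3) (u : ℝ≥0) =>
      brownian (s + u) (ω i k) - brownian s (ω i k)) ∈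
      {p : Config N × PathSpace N | ∀ r ∈ Set.Icc (0 : ℝ) t, (fun i : Fin N =>
        p.1 i + WithLp.toLp 2 (fun k : Fin 3 =>
          Real.sqrt 2 * pathRegularize (p.2 i k) r.toNNReal)) ∈ boxN N L}) ↔
      ω ∈ {ω' : PathSpace N | ∀ r ∈ Set.Icc (0 : ℝ) t,
        worldLine X ω' (s + r.toNNReal) ∈ boxN N L} := by
    simp only [Set.mem_setOf_eq, raw_worldLine_pathsShift]
  have hact : (∫⁻ r in Set.Ioc (0 : ℝ) t, interaction v (fun i : Fin N => worldLine X ω s i +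
      WithLp.toLp 2 (fun k : Fin 3 => Real.sqrt 2 * pathRegularize
        (fun u => brownian (s + u) (ω i k) - brownian s (ω i k)) r.toNNReal))) =
      ∫⁻ r in Set.Ioc (0 : ℝ) t, interaction v (worldLine X ω (s + r.toNNReal)) := by
    simp only [raw_worldLine_pathsShift]
  by_cases hω : ω ∈ {ω' : PathSpace N | ∀ r ∈ Set.Icc (0 : ℝ) t,
      worldLine X ω' (s + r.toNNReal) ∈ boxN N L}
  · rw [Set.indicator_of_mem hω, Set.indicator_of_mem (hmem.2 hω), hact]
  · rw [Set.indicator_of_notMem hω, Set.indicator_of_notMem (fun h => hω (hmem.1 h))]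

/-- **The raw weight of the stopped paths `u ↦ b_{u ∧ s}` on `[0, s]` is the weight on `[0, s]`.**
[folklore] -/
theorem rawWeight_stopped (v : ℝ → ℝ≥0∞) (L : ℝ) (s : ℝ≥0) (X : Config N) (ω : PathSpace N) :
    {p : Config N × PathSpace N | ∀ r ∈ Set.Icc (0 : ℝ) s, (fun i : Fin N =>
        p.1 i + WithLp.toLp 2 (fun k : Fin 3 =>
          Real.sqrt 2 * pathRegularize (p.2 i k) r.toNNReal)) ∈ boxN N L}.indicator
      (fun p => expNeg (∫⁻ r in Set.Ioc (0 : ℝ) s,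
        interaction v (fun i : Fin N => p.1 i + WithLp.toLp 2 (fun k : Fin 3 =>
          Real.sqrt 2 * pathRegularize (p.2 i k) r.toNNReal))))
      (X, fun i k u => brownian (min u s) (ω i k)) = fkWeight v L s X ω := by
  have hmem : ((X, fun (i : Fin N) (k : Fin 3) (u : ℝ≥0) => brownian (min u s) (ω i k)) ∈
      {p : Config N × PathSpace N | ∀ r ∈ Set.Icc (0 : ℝ) s, (fun i : Fin N =>
        p.1 i + WithLp.toLp 2 (fun k : Fin 3 =>
          Real.sqrt 2 * pathRegularize (p.2 i k) r.toNNReal)) ∈ boxN N L}) ↔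
      ω ∈ survives L s X := by
    simp only [Set.mem_setOf_eq, survives, raw_worldLine_stopped]
    refine forall₂_congr fun r hr => ?_
    rw [min_eq_left (Real.toNNReal_le_iff_le_coe.2 hr.2)]
  have hact : (∫⁻ r in Set.Ioc (0 : ℝ) s, interaction v (fun i : Fin N => X i +
      WithLp.toLp 2 (fun k : Fin 3 => Real.sqrt 2 *
        pathRegularize (fun u => brownian (min u s) (ω i k)) r.toNNReal))) = pathAction v s X ω := by
    simp only [pathAction, raw_worldLine_stopped]
    refine setLIntegral_congr_fun measurableSet_Ioc (fun r hr => ?_)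
    rw [min_eq_left (Real.toNNReal_le_iff_le_coe.2 hr.2)]
  simp only [fkWeight]
  by_cases hω : ω ∈ survives L s X
  · rw [Set.indicator_of_mem hω, Set.indicator_of_mem (hmem.2 hω), hact]
  · rw [Set.indicator_of_notMem hω, Set.indicator_of_notMem (fun h => hω (hmem.1 h))]

/-! ### Measurability consequences -/

/-- **Joint measurability of the Feynman–Kac weight** in the starting point and the sample,
`(X, ω) ↦ fkWeight v L t X ω` (through the raw weight of the Brownian paths). [folklore] -/
theorem measurable_fkWeight_uncurry {v : ℝ → ℝ≥0∞} (hv : Measurable v) (L t : ℝ) :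
    Measurable fun p : Config N × PathSpace N => fkWeight v L t p.1 p.2 := by
  have hφ : Measurable fun p : Config N × PathSpace N =>
      (p.1, fun (i : Fin N) (k : Fin 3) (u : ℝ≥0) => brownian u (p.2 i k)) :=
    measurable_fst.prodMk ((measurable_pathsPath N).comp measurable_snd)
  have h := (measurable_rawWeight N hv L t).comp hφ
  have heq : (fun p : Config N × PathSpace N => fkWeight v L t p.1 p.2) =
      (fun p : Config N × PathSpace N =>
      {p : Config N × PathSpace N | ∀ r ∈ Set.Icc (0 : ℝ) t, (fun i : Fin N =>
        p.1 i + WithLp.toLp 2 (fun k : Fin 3 =>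
          Real.sqrt 2 * pathRegularize (p.2 i k) r.toNNReal)) ∈ boxN N L}.indicator
      (fun p => expNeg (∫⁻ r in Set.Ioc (0 : ℝ) t,
        interaction v (fun i : Fin N => p.1 i + WithLp.toLp 2 (fun k : Fin 3 =>
          Real.sqrt 2 * pathRegularize (p.2 i k) r.toNNReal)))) p) ∘
      fun p : Config N × PathSpace N =>
        (p.1, fun (i : Fin N) (k : Fin 3) (u : ℝ≥0) => brownian u (p.2 i k)) := by
    funext p
    simp only [Function.comp_apply]
    exact (rawWeight_pathsPath v L t p.1 p.2).symm
  rw [heq]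
  exact h

/-- The world-line at a fixed time is jointly measurable in `(X, ω)`. [folklore] -/
theorem measurable_worldLine_uncurry' (r : ℝ≥0) :
    Measurable fun p : Config N × PathSpace N => worldLine p.1 p.2 r := by
  have hφ : Measurable fun p : Config N × PathSpace N =>
      (p.1, fun (i : Fin N) (k : Fin 3) (u : ℝ≥0) => brownian u (p.2 i k)) :=
    measurable_fst.prodMk ((measurable_pathsPath N).comp measurable_snd)
  have h := (measurable_rawWorldLine_at' N r).comp hφ
  have heq : (fun p : Config N × PathSpace N => worldLine p.1 p.2 r) =
      (fun p : Config N × PathSpace N => fun i : Fin N =>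
        p.1 i + WithLp.toLp 2 (fun k : Fin 3 => Real.sqrt 2 * pathRegularize (p.2 i k) r)) ∘
      fun p : Config N × PathSpace N =>
        (p.1, fun (i : Fin N) (k : Fin 3) (u : ℝ≥0) => brownian u (p.2 i k)) := by
    funext p
    simp only [Function.comp_apply]
    exact (raw_worldLine_pathsPath p.1 p.2 r).symm
  rw [heq]
  exact h

/-- **Measurability of the Feynman–Kac functional in the starting point**:
`X ↦ (e^{-tH_N} g)(X)` is measurable for measurable `v` and `g`. [folklore] -/
theorem measurable_fkSemigroup {v : ℝ → ℝ≥0∞} (hv : Measurable v) (L t : ℝ)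
    {g : Config N → ℝ≥0∞} (hg : Measurable g) : Measurable (fkSemigroup v L t g) := by
  have h : Measurable fun p : Config N × PathSpace N =>
      fkWeight v L t p.1 p.2 * g (worldLine p.1 p.2 t.toNNReal) :=
    (measurable_fkWeight_uncurry hv L t).mul (hg.comp (measurable_worldLine_uncurry' t.toNNReal))
  exact h.lintegral_prod_right'

/-- The Feynman–Kac functional of a measurable observable is a measurable function (dot-free
form, for rewriting under binders). [folklore] -/
theorem measurable_fkSemigroup' {v : ℝ → ℝ≥0∞} (hv : Measurable v) (L t : ℝ)
    {g : Config N → ℝ≥0∞} (hg : Measurable g) : Measurable fun X => fkSemigroup v L t g X :=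
  measurable_fkSemigroup hv L t hg

/-- **The weight on `[0, s]` and the position at time `s` are functionals of the past**
`(b_u(ω i k))_{u ≤ s}`: `ω ↦ (fkWeight v L s X ω, worldLine X ω s)` is measurable with respect to
`σ(b_u(ω i k) : u ≤ s)` (read the stopped paths `u ↦ b_{u ∧ s}`, a measurable function of the
past, through the raw functionals). [folklore] -/
theorem measurable_comap_past_fkWeight_worldLine {v : ℝ → ℝ≥0∞} (hv : Measurable v) (L : ℝ)
    (s : ℝ≥0) (X : Config N) :
    Measurable[MeasurableSpace.comap (fun (ω : PathSpace N) (i : Fin N) (k : Fin 3)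
      (u : Set.Iic s) => brownian u (ω i k)) inferInstance]
      fun ω : PathSpace N => (fkWeight v L s X ω, worldLine X ω s) := by
  -- the raw functional `w ↦ (rawWeight s X w, rawWorldLine X w s)`
  have hF : Measurable fun w : PathSpace N =>
      ({p : Config N × PathSpace N | ∀ r ∈ Set.Icc (0 : ℝ) s, (fun i : Fin N =>
        p.1 i + WithLp.toLp 2 (fun k : Fin 3 =>
          Real.sqrt 2 * pathRegularize (p.2 i k) r.toNNReal)) ∈ boxN N L}.indicator
      (fun p => expNeg (∫⁻ r in Set.Ioc (0 : ℝ) s,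
        interaction v (fun i : Fin N => p.1 i + WithLp.toLp 2 (fun k : Fin 3 =>
          Real.sqrt 2 * pathRegularize (p.2 i k) r.toNNReal)))) (X, w),
      fun i : Fin N => X i + WithLp.toLp 2 (fun k : Fin 3 =>
        Real.sqrt 2 * pathRegularize (w i k) s)) :=
    ((measurable_rawWeight N hv L s).comp (measurable_const.prodMk measurable_id)).prodMk
      ((measurable_rawWorldLine_at' N s).comp (measurable_const.prodMk measurable_id))
  -- the stopped extension of a past
  have hEXT : Measurable fun (p : Fin N → Fin 3 → (Set.Iic s → ℝ)) (i : Fin N) (k : Fin 3)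
      (u : ℝ≥0) => p i k ⟨min u s, min_le_right u s⟩ := by
    refine measurable_pi_lambda _ fun i => measurable_pi_lambda _ fun k =>
      measurable_pi_lambda _ fun u => ?_
    exact (measurable_pi_apply _).comp ((measurable_pi_apply k).comp (measurable_pi_apply i))
  have heq : (fun ω : PathSpace N => (fkWeight v L s X ω, worldLine X ω s)) =
      ((fun w : PathSpace N =>
      ({p : Config N × PathSpace N | ∀ r ∈ Set.Icc (0 : ℝ) s, (fun i : Fin N =>
        p.1 i + WithLp.toLp 2 (fun k : Fin 3 =>
          Real.sqrt 2 * pathRegularize (p.2 i k) r.toNNReal)) ∈ boxN N L}.indicator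
      (fun p => expNeg (∫⁻ r in Set.Ioc (0 : ℝ) s,
        interaction v (fun i : Fin N => p.1 i + WithLp.toLp 2 (fun k : Fin 3 =>
          Real.sqrt 2 * pathRegularize (p.2 i k) r.toNNReal)))) (X, w),
      fun i : Fin N => X i + WithLp.toLp 2 (fun k : Fin 3 =>
        Real.sqrt 2 * pathRegularize (w i k) s))) ∘
      (fun (p : Fin N → Fin 3 → (Set.Iic s → ℝ)) (i : Fin N) (k : Fin 3) (u : ℝ≥0) =>
        p i k ⟨min u s, min_le_right u s⟩)) ∘
      fun (ω : PathSpace N) (i : Fin N) (k : Fin 3) (u : Set.Iic s) => brownian u (ω i k) := by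
    funext ω
    simp only [Function.comp_apply]
    rw [rawWeight_stopped v L s X ω, raw_worldLine_stopped X ω s s, min_self]
  rw [heq]
  exact (hF.comp hEXT).comp (comap_measurable _)

/-! ### The semigroup law -/

/-- **Semigroup law of the Feynman–Kac functional** (`ℝ≥0` times): for measurable `v` and `g`,
`(e^{-(s+t)H_N} g)(X) = (e^{-sH_N} (e^{-tH_N} g))(X)` for every `X` — the Markov property of the
world-lines at time `s` (`lintegral_comp_pathsShift_eq`) applied to the raw functional
`w ↦ 𝟙{τ > t} e^{-∫₀ᵗ V} g(B_t)` started from `B_s`, whose value on the shifted paths is the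
`[s, s+t]`-part of the weight (`fkWeight_add_eq_mul`, `rawWeight_pathsShift`). Chung–Zhao (1995),
§3.2 (display before Thm 3.10) with (3.34).
[cite: ChungZhao1995, §3.2 (before Thm 3.10) and §3.3 (3.34)] -/
theorem fkSemigroup_add_nnreal {v : ℝ → ℝ≥0∞} (hv : Measurable v) (L : ℝ) (s t : ℝ≥0)
    {g : Config N → ℝ≥0∞} (hg : Measurable g) (X : Config N) :
    fkSemigroup v L ((s : ℝ) + t) g X = fkSemigroup v L s (fkSemigroup v L t g) X := by
  -- measurability of the raw functional `G((a, Y), w) = a · rawWeight t Y w · g(rawWorldLine Y w t)`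
  have hGm : Measurable fun q : (ℝ≥0∞ × Config N) × PathSpace N =>
      q.1.1 * ({p : Config N × PathSpace N | ∀ r ∈ Set.Icc (0 : ℝ) t, (fun i : Fin N =>
        p.1 i + WithLp.toLp 2 (fun k : Fin 3 =>
          Real.sqrt 2 * pathRegularize (p.2 i k) r.toNNReal)) ∈ boxN N L}.indicator
      (fun p => expNeg (∫⁻ r in Set.Ioc (0 : ℝ) t,
        interaction v (fun i : Fin N => p.1 i + WithLp.toLp 2 (fun k : Fin 3 =>
          Real.sqrt 2 * pathRegularize (p.2 i k) r.toNNReal)))) (q.1.2, q.2) *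
        g (fun i : Fin N => q.1.2 i + WithLp.toLp 2 (fun k : Fin 3 =>
          Real.sqrt 2 * pathRegularize (q.2 i k) t))) := by
    have hπ : Measurable fun q : (ℝ≥0∞ × Config N) × PathSpace N => (q.1.2, q.2) :=
      (measurable_snd.comp measurable_fst).prodMk measurable_snd
    refine (measurable_fst.comp measurable_fst).mul ?_
    exact ((measurable_rawWeight N hv L t).comp hπ).mul
      (hg.comp ((measurable_rawWorldLine_at' N t).comp hπ))
  have key := lintegral_comp_pathsShift_eq N s
    (measurable_comap_past_fkWeight_worldLine hv L s X) hGm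
  have e : ((s : ℝ) + t).toNNReal = s + t := by
    rw [← NNReal.coe_add, Real.toNNReal_coe]
  simp only [rawWeight_pathsShift, rawWeight_pathsPath, raw_worldLine_pathsShift,
    raw_worldLine_pathsPath] at key
  rw [fkSemigroup, e, fkSemigroup]
  simp only [fkWeight_add_eq_mul v L s t X, mul_assoc]
  rw [key]
  refine lintegral_congr fun ω => ?_
  rw [lintegral_const_mul' _ _ ((fkWeight_le_one v L s X ω).trans_lt ENNReal.one_lt_top).ne]
  simp only [fkSemigroup, Real.toNNReal_coe]

/-- **Semigroup law of the Feynman–Kac functional**: for `s, t ≥ 0`, measurable `v` and `g`, and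
every `X`, `fkSemigroup v L (s + t) g X = fkSemigroup v L s (fkSemigroup v L t g) X`
(`e^{-(s+t)H_N} = e^{-sH_N} e^{-tH_N}` path-wise). Chung–Zhao (1995), §3.2 with (3.34).
[cite: ChungZhao1995, §3.2 (before Thm 3.10) and §3.3 (3.34)] -/
theorem fkSemigroup_add {v : ℝ → ℝ≥0∞} (hv : Measurable v) (L : ℝ) {s t : ℝ} (hs : 0 ≤ s)
    (ht : 0 ≤ t) {g : Config N → ℝ≥0∞} (hg : Measurable g) (X : Config N) :
    fkSemigroup v L (s + t) g X = fkSemigroup v L s (fkSemigroup v L t g) X := by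
  lift s to ℝ≥0 using hs
  lift t to ℝ≥0 using ht
  exact fkSemigroup_add_nnreal hv L s t hg X

/-- The semigroup law for the partition function: `Z_{s+t}(X) = (e^{-sH_N} Z_t)(X)`. [folklore] -/
theorem fkPartition_add {v : ℝ → ℝ≥0∞} (hv : Measurable v) (L : ℝ) {s t : ℝ} (hs : 0 ≤ s)
    (ht : 0 ≤ t) (X : Config N) :
    fkPartition v L (s + t) X = fkSemigroup v L s (fkPartition v L t) X :=
  fkSemigroup_add hv L hs ht measurable_const X

end Literature.MathematicalPhysics.QuantumManyBody.BoseGas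

end
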